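import Summits.CriticalPhenomena.PercolationContinuityZ3.Theorems.PercNearOneGluingNoHeavyLowerTailKnQuestion8CoefficientwiseCoreClassSeriesMain
import Summits.CriticalPhenomena.PercolationContinuityZ3.Theorems.PercNearOneGluingNoHeavyLowerTailKnQuestion8CoefficientwiseCoreClassDomBundle
import HarnessLib

/-!
# THEOREM KB-SERIES, unconditional instances: `a` adjacent to all of `H₁`

Support file (`--supports stmt-CriticalPhenomena-4575`, closed), prover `prim-cplus-coupling` (gen 31).  No definitions, no notations, no named facts,
no sorries; standard axioms.  Memo `prim-cplus-coupling/A5-COUPLING-gen31.md` §2b.  On top of `…CoreClassSeriesMain` (`cwpa_coreClass_of_series`: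
series composition from proper domination maps of the blocks and the one-sided root inequality OSR for `(E₁; c, a)`).
* `Coefficientwise.oneSidedRoot_of_adj` — `OSR(E₁; c, a)` holds when every vertex `≠ a` on an edge of `E₁` is joined to `a` by an edge of `E₁`: on the
  event `{a ∈ C_c ω₁ ∖ C_c(E₁∖ω₁)}` the blue cluster `C_c(E₁∖ω₁)` lies inside the red cluster `C_c ω₁`, so every term is a product of two nonnegative factors.
* `Coefficientwise.cwpa_coreClass_of_series_adj_pocketFree` — CW-PA (all monotone `f, g`) on the core class `N(x) = N(z) = {a, b}` over `E₁ ·_c E₂` with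
  `a` adjacent to all of `H₁` (triangle, fans, wheels with hub `a`, `K_{2,r} + ca`, …; the domination map of `(E₁; a, c)` is the involution `R_A`, proper) and
  `(H₂; c, b)` pocket-free (domination map `R_A` at root `c`).
* `Coefficientwise.cwpa_coreClass_of_series_adj_degLeTwo` — the same with `H₂` of internal degree `≤ 2` at `(c, b)` (every bundle `Θ(k₁,…,k_r)`), e.g. the
  8-vertex middle graph `Θ(1,2)·Θ(2,2,2,2)` on which the RESTRICTED invariant fails (memo §3.3) — a family outside domination maps, leaves and parallel products.
[cite: KozmaNitzan2024, Questions 8–9 (§5.5 p. 36) (context: the Question-8 pocket covariance programme)]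
-/

namespace Summit.CriticalPhenomena.PercolationContinuityZ3.Theorems

open Finset Literature.Probability.Percolation
open scoped symmDiff

namespace Coefficientwise

variable {ι V : Type*}

open Classical in
/-- **The one-sided root inequality when `a` is adjacent to everything.**  If every vertex `y ≠ a` lying on an edge of `E₁` is joined to `a` by an edge of
`E₁`, then for all monotone `H ≥ Hᵇ ≥ 0`, `K ≥ Kᵇ ≥ 0`:
`0 ≤ Σ_{ω₁ ⊆ E₁ : a ∈ C_c ω₁, a ∉ C_c(E₁∖ω₁)} (H(C_c ω₁) − Hᵇ(C_c(E₁∖ω₁)))(K(C_c ω₁) − Kᵇ(C_c(E₁∖ω₁)))`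
(on that event the blue cluster of `c` lies inside its red cluster, so both factors are nonnegative). [cite: KozmaNitzan2024, Questions 8–9 (§5.5 p. 36) (context)] -/
theorem oneSidedRoot_of_adj (ends : ι → Sym2 V) (E₁ : Finset ι) (c a : V)
    (hadj : ∀ y, y ≠ a → (∃ i ∈ E₁, y ∈ ends i) → ∃ j ∈ E₁, ends j = s(a, y))
    (H Hb K Kb : Set V → ℝ) (hH : Monotone H) (hK : Monotone K)
    (hHb : ∀ X, Hb X ≤ H X) (hKb : ∀ X, Kb X ≤ K X) :
    0 ≤ ∑ ω₁ ∈ E₁.powerset, (if a ∈ openCluster (ends '' (↑ω₁ : Set ι)) c ∧ a ∉ openCluster (ends '' (↑(E₁ \ ω₁) : Set ι)) c then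
        (H (openCluster (ends '' (↑ω₁ : Set ι)) c) - Hb (openCluster (ends '' (↑(E₁ \ ω₁) : Set ι)) c)) *
          (K (openCluster (ends '' (↑ω₁ : Set ι)) c) - Kb (openCluster (ends '' (↑(E₁ \ ω₁) : Set ι)) c)) else 0) := by
  refine Finset.sum_nonneg fun ω₁ _ => ?_
  by_cases hR : a ∈ openCluster (ends '' (↑ω₁ : Set ι)) c ∧ a ∉ openCluster (ends '' (↑(E₁ \ ω₁) : Set ι)) c
  · rw [if_pos hR]
    have hsub : openCluster (ends '' (↑(E₁ \ ω₁) : Set ι)) c ⊆ openCluster (ends '' (↑ω₁ : Set ι)) c := by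
      intro y hy
      by_cases hyc : y = c
      · rw [hyc]; exact mem_openCluster_self _ _
      · obtain ⟨i, hi, hyi⟩ := exists_edge_of_mem_openCluster ends hy hyc
        have hya : y ≠ a := by rintro rfl; exact hR.2 hy
        obtain ⟨j, hj, hje⟩ := hadj y hya ⟨i, (Finset.mem_sdiff.mp hi).1, hyi⟩
        by_cases hjω : j ∈ ω₁
        · exact mem_openCluster_of_edge ends hjω hje hR.1
        · exfalso
          have hjB : j ∈ E₁ \ ω₁ := Finset.mem_sdiff.mpr ⟨hj, hjω⟩
          have hje' : ends j = s(y, a) := by rw [hje, Sym2.eq_swap]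
          exact hR.2 (mem_openCluster_of_edge ends hjB hje' hy)
    have h1 : 0 ≤ H (openCluster (ends '' (↑ω₁ : Set ι)) c) - Hb (openCluster (ends '' (↑(E₁ \ ω₁) : Set ι)) c) := by
      linarith [hHb (openCluster (ends '' (↑(E₁ \ ω₁) : Set ι)) c), hH hsub]
    have h2 : 0 ≤ K (openCluster (ends '' (↑ω₁ : Set ι)) c) - Kb (openCluster (ends '' (↑(E₁ \ ω₁) : Set ι)) c) := by
      linarith [hKb (openCluster (ends '' (↑(E₁ \ ω₁) : Set ι)) c), hK hsub]
    exact mul_nonneg h1 h2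
  · rw [if_neg hR]

open Classical in
/-- **KB-SERIES, unconditional instance: `a` adjacent to all of `H₁`, `(H₂; c, b)` pocket-free.**  Core-class bookkeeping for `E_H = E₁ ∪ E₂` as in
`cwpa_coreClass_of_series`; every vertex `≠ a` on an edge of `E₁` is joined to `a` by an edge of `E₁`; for every `ω ⊆ E₂` on the wall of `(E₂; c, b)`,
`C_b(E₂∖ω) ⊆ C_c(ω) ∪ C_b({i ∈ E₂∖ω : i meets no vertex of C_c ω})` (pocket-free; all thread bundles `Θ`, `b ~ V(H₂)∖c`, …).  Then CW-PA holds on the core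
class `N(x) = N(z) = {a, b}` over `E₁ ∪ E₂` for all monotone `f, g`. [cite: KozmaNitzan2024, Questions 8–9 (§5.5 p. 36) (context)] -/
theorem cwpa_coreClass_of_series_adj_pocketFree (ends : ι → Sym2 V) (E₁ E₂ E₀ : Finset ι) (x z c a b : V) (ixa ixb iza izb : ι)
    (hdisj : Disjoint E₁ E₂) (hsep : ∀ i ∈ E₁, ∀ j ∈ E₂, ∀ u, u ∈ ends i → u ∈ ends j → u = c)
    (haE : ∀ j ∈ E₂, a ∉ ends j) (hbE : ∀ i ∈ E₁, b ∉ ends i) (hba : b ≠ a)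
    (hxa : ends ixa = s(x, a)) (hxb : ends ixb = s(x, b)) (hza : ends iza = s(z, a)) (hzb : ends izb = s(z, b))
    (hH : ∀ i ∈ E₁ ∪ E₂, x ∉ ends i ∧ z ∉ ends i) (hE₀ : ∀ i, i ∈ E₀ ↔ i ∈ E₁ ∪ E₂ ∨ i = ixa ∨ i = ixb ∨ i = iza ∨ i = izb)
    (hnot : ixa ∉ E₁ ∪ E₂ ∧ ixb ∉ E₁ ∪ E₂ ∧ iza ∉ E₁ ∪ E₂ ∧ izb ∉ E₁ ∪ E₂)
    (hd : ixa ≠ ixb ∧ ixa ≠ iza ∧ ixa ≠ izb ∧ ixb ≠ iza ∧ ixb ≠ izb ∧ iza ≠ izb)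
    (hxz : x ≠ z) (hxa' : x ≠ a) (hxb' : x ≠ b) (hza' : z ≠ a) (hzb' : z ≠ b)
    (hadj : ∀ y, y ≠ a → (∃ i ∈ E₁, y ∈ ends i) → ∃ j ∈ E₁, ends j = s(a, y))
    (hpf : ∀ ω, ω ⊆ E₂ → b ∉ openCluster (ends '' (↑ω : Set ι)) c → b ∉ openCluster (ends '' (↑(E₂ \ ω) : Set ι)) c →
      openCluster (ends '' (↑(E₂ \ ω) : Set ι)) b ⊆ openCluster (ends '' (↑ω : Set ι)) c ∪
        openCluster (ends '' (↑((E₂ \ ω).filter (fun i => ∀ v, v ∈ ends i → v ∉ openCluster (ends '' (↑ω : Set ι)) c)) : Set ι)) b)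
    (f g : Set V → ℝ) (hf : Monotone f) (hg : Monotone g) :
    0 ≤ ∑ s ∈ E₀.powerset.filter (fun s : Finset ι => z ∉ openCluster (ends '' (↑s : Set ι)) x ∧ z ∉ openCluster (ends '' (↑(E₀ \ s) : Set ι)) x),
      f (openCluster (ends '' (↑s : Set ι)) x) * (g (openCluster (ends '' (↑s : Set ι)) x) - g (openCluster (ends '' (↑(E₀ \ s) : Set ι)) x)) := by
  -- pocket-freeness of (E₁; a, c) from the adjacency of `a`
  have hpf₁ : ∀ ω, ω ⊆ E₁ → c ∉ openCluster (ends '' (↑ω : Set ι)) a → c ∉ openCluster (ends '' (↑(E₁ \ ω) : Set ι)) a →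
      openCluster (ends '' (↑(E₁ \ ω) : Set ι)) c ⊆ openCluster (ends '' (↑ω : Set ι)) a ∪
        openCluster (ends '' (↑((E₁ \ ω).filter (fun i => ∀ v, v ∈ ends i → v ∉ openCluster (ends '' (↑ω : Set ι)) a)) : Set ι)) c := by
    intro ω hω hcR hcB y hy
    by_cases hyP : y ∈ openCluster (ends '' (↑ω : Set ι)) a
    · exact Or.inl hyP
    right
    by_cases hyc : y = c
    · rw [hyc]; exact mem_openCluster_self _ _
    have hya : y ≠ a := by rintro rfl; exact hyP (mem_openCluster_self _ _)
    obtain ⟨i, hi, hyi⟩ := exists_edge_of_mem_openCluster ends hy hyc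
    obtain ⟨j, hj, hje⟩ := hadj y hya ⟨i, (Finset.mem_sdiff.mp hi).1, hyi⟩
    exfalso
    by_cases hjω : j ∈ ω
    · exact hyP (mem_openCluster_of_edge ends hjω hje (mem_openCluster_self _ _))
    · have hjB : j ∈ E₁ \ ω := Finset.mem_sdiff.mpr ⟨hj, hjω⟩
      have hje' : ends j = s(y, a) := by rw [hje, Sym2.eq_swap]
      have haB : a ∈ openCluster (ends '' (↑(E₁ \ ω) : Set ι)) c := mem_openCluster_of_edge ends hjB hje' hy
      exact hcB ((mem_openCluster_comm ends (E₁ \ ω) a c).mpr haB)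
  refine cwpa_coreClass_of_series ends E₁ E₂ E₀ x z c a b ixa ixb iza izb hdisj hsep haE hbE hba hxa hxb hza hzb hH hE₀ hnot hd hxz hxa' hxb' hza' hzb'
    (fun ω => ω ∆ E₁.filter (fun i => ∀ v, v ∈ ends i → v ∉ openCluster (ends '' (↑ω : Set ι)) a)) ?_ ?_ ?_ ?_
    (fun ω => ω ∆ E₂.filter (fun i => ∀ v, v ∈ ends i → v ∉ openCluster (ends '' (↑ω : Set ι)) c)) ?_ ?_ ?_ ?_
    (fun H Hb K Kb hH' _ hK' _ _ hHb _ hKb => oneSidedRoot_of_adj ends E₁ c a hadj H Hb K Kb hH' hK' hHb hKb) f g hf hg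
  · intro ω hω _ _ i hi
    rw [Finset.mem_symmDiff, Finset.mem_filter] at hi
    rcases hi with ⟨hi', _⟩ | ⟨hi', _⟩
    · exact hω hi'
    · exact hi'.1
  · intro ω hω hcR hcB
    rw [openCluster_toggleOff_eq ends E₁ ω a]
    intro y hy
    rcases hy with hy | hy
    · exact Or.inl hy
    · rcases hpf₁ ω hω hcR hcB hy with hy' | hy'
      · exact Or.inl hy'
      · exact Or.inr (openCluster_sdiff_off_subset_toggleOff ends E₁ ω a c hy')
  · intro ω₁ ω₂ _ _ _ _ _ _ heq
    have h1 := toggleOff_toggleOff ends E₁ ω₁ a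
    have h2 := toggleOff_toggleOff ends E₁ ω₂ a
    beta_reduce at h1 h2
    rw [← h1, ← h2, heq]
  · intro ω _ hcR _
    rw [openCluster_toggleOff_eq ends E₁ ω a]
    exact hcR
  · intro ω hω _ _ i hi
    rw [Finset.mem_symmDiff, Finset.mem_filter] at hi
    rcases hi with ⟨hi', _⟩ | ⟨hi', _⟩
    · exact hω hi'
    · exact hi'.1
  · intro ω hω hbR hbB
    rw [openCluster_toggleOff_eq ends E₂ ω c]
    intro y hy
    rcases hy with hy | hy
    · exact Or.inl hy
    · rcases hpf ω hω hbR hbB hy with hy' | hy'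
      · exact Or.inl hy'
      · exact Or.inr (openCluster_sdiff_off_subset_toggleOff ends E₂ ω c b hy')
  · intro ω₁ ω₂ _ _ _ _ _ _ heq
    have h1 := toggleOff_toggleOff ends E₂ ω₁ c
    have h2 := toggleOff_toggleOff ends E₂ ω₂ c
    beta_reduce at h1 h2
    rw [← h1, ← h2, heq]
  · intro ω _ hbR _
    rw [openCluster_toggleOff_eq ends E₂ ω c]
    exact hbR

open Classical in
/-- **KB-SERIES, unconditional instance: `a` adjacent to all of `H₁`, `H₂` of internal degree ≤ 2 at `(c, b)`** (every bundle `Θ(k₁,…,k_r)` between `c` and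
`b`; e.g. the 8-vertex witness `Θ(1,2)·Θ(2,2,2,2)` against the restricted invariant).  CW-PA holds on the core class over `E₁ ∪ E₂` for all monotone `f, g`.
[cite: KozmaNitzan2024, Questions 8–9 (§5.5 p. 36) (context)] -/
theorem cwpa_coreClass_of_series_adj_degLeTwo (ends : ι → Sym2 V) (E₁ E₂ E₀ : Finset ι) (x z c a b : V) (ixa ixb iza izb : ι)
    (hdisj : Disjoint E₁ E₂) (hsep : ∀ i ∈ E₁, ∀ j ∈ E₂, ∀ u, u ∈ ends i → u ∈ ends j → u = c)
    (haE : ∀ j ∈ E₂, a ∉ ends j) (hbE : ∀ i ∈ E₁, b ∉ ends i) (hba : b ≠ a)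
    (hxa : ends ixa = s(x, a)) (hxb : ends ixb = s(x, b)) (hza : ends iza = s(z, a)) (hzb : ends izb = s(z, b))
    (hH : ∀ i ∈ E₁ ∪ E₂, x ∉ ends i ∧ z ∉ ends i) (hE₀ : ∀ i, i ∈ E₀ ↔ i ∈ E₁ ∪ E₂ ∨ i = ixa ∨ i = ixb ∨ i = iza ∨ i = izb)
    (hnot : ixa ∉ E₁ ∪ E₂ ∧ ixb ∉ E₁ ∪ E₂ ∧ iza ∉ E₁ ∪ E₂ ∧ izb ∉ E₁ ∪ E₂)
    (hd : ixa ≠ ixb ∧ ixa ≠ iza ∧ ixa ≠ izb ∧ ixb ≠ iza ∧ ixb ≠ izb ∧ iza ≠ izb)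
    (hxz : x ≠ z) (hxa' : x ≠ a) (hxb' : x ≠ b) (hza' : z ≠ a) (hzb' : z ≠ b)
    (hadj : ∀ y, y ≠ a → (∃ i ∈ E₁, y ∈ ends i) → ∃ j ∈ E₁, ends j = s(a, y))
    (hdeg : ∀ u, u ≠ c → u ≠ b → ∀ i j l, i ∈ E₂ → j ∈ E₂ → l ∈ E₂ → u ∈ ends i → u ∈ ends j → u ∈ ends l → i = j ∨ i = l ∨ j = l)
    (f g : Set V → ℝ) (hf : Monotone f) (hg : Monotone g) :
    0 ≤ ∑ s ∈ E₀.powerset.filter (fun s : Finset ι => z ∉ openCluster (ends '' (↑s : Set ι)) x ∧ z ∉ openCluster (ends '' (↑(E₀ \ s) : Set ι)) x),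
      f (openCluster (ends '' (↑s : Set ι)) x) * (g (openCluster (ends '' (↑s : Set ι)) x) - g (openCluster (ends '' (↑(E₀ \ s) : Set ι)) x)) := by
  refine cwpa_coreClass_of_series_adj_pocketFree ends E₁ E₂ E₀ x z c a b ixa ixb iza izb hdisj hsep haE hbE hba hxa hxb hza hzb hH hE₀ hnot hd
    hxz hxa' hxb' hza' hzb' hadj ?_ f g hf hg
  intro ω hω hbR hbB
  exact pocketFree_of_deg_le_two ends E₂ c b hdeg ω hω hbR (fun hx => hbB ((mem_openCluster_comm ends (E₂ \ ω) c b).mpr hx))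


end Coefficientwise

end Summit.CriticalPhenomena.PercolationContinuityZ3.Theorems
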